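import Summits.AtomisticToContinuum.HydrodynamicLimit.Theses.AntiMazurCoboundaries
import Summits.AtomisticToContinuum.HydrodynamicLimit.Theses.FluxGibbsianityLdDrude
import Summits.AtomisticToContinuum.HydrodynamicLimit.Theses.TwoClocks
import Summits.AtomisticToContinuum.HydrodynamicLimit.Theorems.KineticWindowGronwall.Negative.CubicMomentDiverges
import Summits.AtomisticToContinuum.HydrodynamicLimit.Theorems.KineticWindowGronwall.Negative.ConsequentLoadBearing
import Literature.Barriers.AtomisticToContinuum.HighMomentumCutoff

/-!
# Crux `KineticWindowGronwall` (stmt-AtomisticToContinuum-9282) — skeleton line `explosion-limited-jamming`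

Crux (FIXED, route AntiMazurCoboundaries, shared with FluxGibbsianityLdDrude):
`KineticWindowGronwall := KineticFluxLdDecay → RelEntropyVanishing`.

Idea card `Cruxes/KineticWindowGronwall/Ideas/explosion-limited-jamming.md` (triage r1: pass ×3), scoped to the
COLLISIONAL a-priori input of the kinetic-window relative-entropy Gronwall. LEVER: the centre-of-mass
Lagrange–Jacobi (Clausius virial) identity of a cluster `S` of hard spheres lifted to `ℝ³`,
`b_S = Σ_{a∈S} ⟪x_a − X_S, v_a − V_S⟫`, `ḃ_S = 2 K_S` in free flight, `Δb_S = + ε |[v]|` at each internal collision,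
so that on every isolation interval `ε Σ_internal |[v]| ≤ 2 √(2 K_S I_S(start))` (the `2 K_S t` cancel): a cluster converts
at most (gyration radius × momentum) into collisional impulse — JAMMING IS EXPLOSION-LIMITED (CIP 1994 Lemma 4.2.3;
Vaserstein 1979; Illner 1989).

PLANNER AUDIT OF THE CARD'S TRANSFER (this seat; details in `Lines/explosion-limited-jamming.md` §Audit). The card and the
triage aimed the lever at TwoClocks' `CollisionActivityTails` (13734: clamp remainder IN MEAN at a FIXED activity level `V`).
That target is NOT reachable by the card's route: (i) the equilibrium superexponential estimate C⁺ holds only in the order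
`∀β ∀ε ∃V` (level after amplitude) — at fixed `V` an exploding macroscopic blob (static cost `≈ 3αN log(V/θσ)`, integrated
gain `≥ c σ√θ α^{4/3} N`, both `τ`- and `N`-free) gives a positive rate for `β > β*(V)`; (ii) every transfer with an
EXTENSIVE entropy/domination budget (`c₁N = H(ψ₀|G)` or `KN` from `ψ₀ ≤ e^{KN} G_hot`) therefore yields only
`E^f[N⁻¹∫tail_V] ≤ c₁/β*(V)`, the order `∀ε ∃V`; (iii) every ACTIVITY-clamp dock needs the fixed-`V` order, because the
clamped collisional LD's amplitude degrades like `β₀(V) ≲ c(K_V)/(V‖∇φ‖)` (the 14441 blob witness at the clamp threshold),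
and count-currency repairs put `W(ε)/c(δ)` into the Gronwall rate. REPAIR ADOPTED HERE: a STATIC clamp (local
over-density at some scale `≥ Lℓ` at level `Λ`, or a neighbour within `(1+g₀)ε_N`, read off the configuration at the window
start). Refining the clamp (`L → ∞`, `g₀ → 0`) drives the bad fraction to `0` by STATICS; the lever then bites three times:
(a) statically-good matter is hyperactive only TRANSIENTLY (budget ∝ extent ∝ n^{1/3}ℓ against window `τℓ`), so the
clamped LD's amplitude degrades only like `τ/L` and is restored by `τ ≥ M L` (`stub_staticClampedCollisionalLd`);
(b) mesoscopic bad clusters have gain/cost `→ 0` under refinement, so their integrated activity obeys an equilibrium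
superexponential estimate in the NATURAL order `∀β ∀ε ∃(ρ₀, L, g₀)` (`stub_mesoJammedSetLd`, the card's C⁺ re-aimed),
consumed by the dock per macroscopic stretch with the RUNNING entropy at a fixed large amplitude and its blockwise
localisation engine (not through the card's global transfer, whose `β = K/ε` coupling re-creates a `log(1/ε)` divergence
of the rate — see `StaticClampDock`); (c) macroscopic near-packed blobs are handled INSIDE the dock in count currency with
the running entropy (their reference cost is extensive) against the fed-cluster budget as a BOUNDED weight, a FIXED
coefficient in the Gronwall rate (`stub_staticClampDock`). Net effect, in the card's words: the non-equilibrium a-priori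
estimate "no transient jamming under the TRUE law" (TwoClocks #7) DISAPPEARS from the hypotheses — what is left is
deterministic kinematics plus ONE equilibrium anti-focusing bound plus entropy bookkeeping.

Registered stubs (6) and composition `KineticWindowGronwall_of` (sorry-free, concludes the crux BY NAME):
`stub_clusterVirialBudget` (deterministic lever, isolated ∧ fed) → `stub_mesoJammedSetLd` (LOAD-BEARING, anti-focusing
K2) ; `stub_staticClampedCollisionalLd` (collisional twin with the static clamp; fixed-σ kinetic wall) ;
`stub_inheritedDockInputs` (Gaussian velocity tails `HighMomentumCutoff`, cubic UI 9235, uniform local-Gibbs LLN 14445,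
low-density EOS 0768, dilute guard 3091 — tree / TwoClocks decls verbatim) ; `stub_kineticClassUpgrade` (the crux's
TYPING DEBT BN1/BN3/S2: bounded → σ-locally-uniform quadratic class; dissolves under the re-typing of 10967 requested by
ideator 3 and all three triagers) ; `stub_staticClampDock` (Yau/OVY/NY ledger with the merged localisation lever and
the static-clamp bookkeeping).

Disproof.lean used: §1 (`not_crux_iff`: content is "B from A" — every stub is on the B-from-A side); §2–§3 HONOURED — the
dock's conclusion is `RelEntropyVanishing` verbatim (tie and balance laws intact; `Negative/ConsequentLoadBearing`
imported below and instantiated in `honours_tie`); §4 HONOURED — no exponential moment of a functional cubic in the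
velocities is taken: the exponentiated activity is the plain impulse sum (a cascade gives `u²/√θ`), the
velocity-weighted variant (`u² log u`, no exponential moment) is rejected for that reason (`Negative/CubicMomentDiverges`
imported; see `honours_cubic`), and velocity tails enter only through `HighMomentumCutoff` / `EnergyCurrentTails`
(TRUE-law inputs, used in mean / through Chebyshev inside the dock); §5.5 / `discreteWindowGronwall_exp` — the dock's
bookkeeping is the h-weighted ledger (one window of dynamics per pressure).
-/

noncomputable section

open scoped BigOperators ENNReal Classical
open MeasureTheory Set
open Literature.MathematicalPhysics.KineticTheory (T3 V3 hsDiameter localGibbsLaw hsCompressibility)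
open Literature.Analysis.FluidPDE

namespace Summit.AtomisticToContinuum.HydrodynamicLimit.Cruxes.KineticWindowGronwall.ExplosionLimitedJamming

open Summit.AtomisticToContinuum.HydrodynamicLimit.Theses.AntiMazurCoboundaries
  (KineticFluxLdDecay RelEntropyVanishing KineticWindowGronwall)
open Summit.AtomisticToContinuum.HydrodynamicLimit.Theses.TwoClocks
  (EnergyCurrentTails UniformLocalGibbsConcentration HsEosLowDensity DiluteSelfConsistency)

/-- Sanity: the crux is literally `KineticFluxLdDecay → RelEntropyVanishing`. -/
example : KineticWindowGronwall = (KineticFluxLdDecay → RelEntropyVanishing) := rfl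

/-! ## §0 Vocabulary -/

/-- The hard-sphere flow of `N+1` spheres at reduced density `σ` on `𝕋³`. -/
abbrev TFlow (σ : ℝ) (N : ℕ) : Type :=
  HardSphereFlow (Torus.geometry (Fin 3)) (hsDiameter σ N) (N + 1)

/-- Torus phase space of `N+1` spheres. -/
abbrev TConfig (N : ℕ) : Type := Config (N + 1) (Fin 3) T3

/-- The kinetic window `w = τ ℓ`, `ℓ = (N+1)^{-1/3}` (macroscopically vanishing, `τ × O(1)` mean free times). -/
def window (τ : ℝ) (N : ℕ) : ℝ := τ * ((N : ℝ) + 1) ^ (-(1 / 3 : ℝ))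

/-- WINDOW COLLISIONAL ACTIVITY of particle `i` over `(s, s + w]` along the orbit of `z`:
`(σ/τ) Σ_{collisions of i in the window} ‖v_i⁺ − v_i⁻‖` (ordered-pair collision sum, `fst = i`) — VERBATIM the
activity `act` of TwoClocks' items 13733/13734. Normalisation: `∫ jact ds = ε_N Σ_c ‖Δv_i‖` since `w σ/τ = σ ℓ = ε_N`.
Deliberately NOT velocity-weighted: a fast particle (speed `u`) entering a bad cluster cascades with
`Σ_c ‖Δv‖ ≍ u²/√θ` (quadratic: exponential moments finite for `N ≥ N₀(β)` since the gain is `β σ ℓ u²/√θ`), whereas the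
velocity-weighted sum `Σ_c ‖Δv‖‖v‖ ≍ u² log(u²/θ)` has NO exponential moment under any Maxwellian (cf. Disproof §4);
the energy-transfer remainder of the dock is therefore split as `‖Δv‖(min(‖v‖,C) + (‖v‖−C)₊)`, the excess being a
velocity-tail (true-law) input, not a jamming input. -/
def jact {σ : ℝ} {N : ℕ} (Φ : TFlow σ N) (τ : ℝ) (i : Fin (N + 1)) (s : ℝ) (z : TConfig N) : ℝ :=
  σ / τ * Φ.collisionSum (Set.Ioc s (s + window τ N))
    (fun c => if c.fst = i then ‖c.postVel.1 - c.preVel.1‖ else 0) z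

/-- Number of particles within torus distance `r` of particle `i` (itself included). -/
def ballCount {N : ℕ} (z : TConfig N) (i : Fin (N + 1)) (r : ℝ) : ℕ :=
  (Finset.univ.filter fun j : Fin (N + 1) => ‖(Torus.geometry (Fin 3)).sepVec (z j).1 (z i).1‖ ≤ r).card

/-- THE STATIC CLAMP. Particle `i` is BAD in `z` at level `Λ`, scale `L`, contact tolerance `g₀` iff the ball of some
radius `r ∈ [L ℓ, 1/4]` around it holds at least `Λ` times the mean count `(N+1)·(4π/3) r³`, OR some other centre is
within `(1 + g₀) ε_N` (a near contact). Read off ONE configuration; no dynamics. (Every colliding pair is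
momentarily near-contact-flagged during its approach, for a time `≍ g₀ ε_N/|v_rel|`: a vanishing weight, harmless in
both currencies.) -/
def IsBad (σ Λ L g₀ : ℝ) {N : ℕ} (z : TConfig N) (i : Fin (N + 1)) : Prop :=
  (∃ r : ℝ, L * ((N : ℝ) + 1) ^ (-(1 / 3 : ℝ)) ≤ r ∧ r ≤ 1 / 4 ∧
      Λ * (((N : ℝ) + 1) * (4 * Real.pi / 3 * r ^ 3)) ≤ (ballCount z i r : ℝ)) ∨
  (∃ j : Fin (N + 1), j ≠ i ∧ ‖(Torus.geometry (Fin 3)).sepVec (z j).1 (z i).1‖ < (1 + g₀) * hsDiameter σ N)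

/-- MACROSCOPIC over-density flag: the ball of MACROSCOPIC radius `ρ₀` around `i` holds at least `Λ` times its mean
count. These particles are treated inside the dock in probability currency (their reference cost is extensive). -/
def IsMacro (Λ ρ₀ : ℝ) {N : ℕ} (z : TConfig N) (i : Fin (N + 1)) : Prop :=
  Λ * (((N : ℝ) + 1) * (4 * Real.pi / 3 * ρ₀ ^ 3)) ≤ (ballCount z i ρ₀ : ℝ)

/-- The MESOSCOPIC JAMMED-SET ACTIVITY FUNCTIONAL over `[0, T]` along the orbit of `z`: the time integral of the
velocity-weighted window activities of the particles that are bad but not macroscopically over-dense at the current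
time. This is what the dock's static clamp leaves over, minus the macroscopic blobs. -/
def mesoBadActivity {σ : ℝ} {N : ℕ} (Φ : TFlow σ N) (Λ ρ₀ L g₀ τ T : ℝ) (z : TConfig N) : ℝ :=
  ∫ s in (0 : ℝ)..T, ∑ i : Fin (N + 1),
    (if IsBad σ Λ L g₀ (Φ.flow s z) i ∧ ¬ IsMacro Λ ρ₀ (Φ.flow s z) i then jact Φ τ i s z else 0)

/-! ### Centre-of-mass cluster quantities for configurations lifted to `ℝ³` -/

section Cluster

variable {n : ℕ}

/-- Centre of mass of the cluster `S`. -/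
def cmPos (S : Finset (Fin n)) (z : Config n (Fin 3) V3) : V3 := (S.card : ℝ)⁻¹ • ∑ a ∈ S, (z a).1

/-- Mean velocity of the cluster `S`. -/
def cmVel (S : Finset (Fin n)) (z : Config n (Fin 3) V3) : V3 := (S.card : ℝ)⁻¹ • ∑ a ∈ S, (z a).2

/-- The centre-of-mass VIRIAL `b_S = Σ_{a∈S} ⟪x_a − X_S, v_a − V_S⟫` (half the time derivative of `cmInertia` in flight;
the tree's `Literature.Barriers.AtomisticToContinuum.virial` is the `S = univ`, origin-centred version). -/
def cmVirial (S : Finset (Fin n)) (z : Config n (Fin 3) V3) : ℝ :=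
  ∑ a ∈ S, inner ℝ ((z a).1 - cmPos S z) ((z a).2 - cmVel S z)

/-- Moment of inertia about the centre of mass, `I_S = Σ_{a∈S} ‖x_a − X_S‖²`. -/
def cmInertia (S : Finset (Fin n)) (z : Config n (Fin 3) V3) : ℝ := ∑ a ∈ S, ‖(z a).1 - cmPos S z‖ ^ 2

/-- Kinetic energy in the centre-of-mass frame, `K_S = ½ Σ_{a∈S} ‖v_a − V_S‖²`. -/
def cmKinetic (S : Finset (Fin n)) (z : Config n (Fin 3) V3) : ℝ := 2⁻¹ * ∑ a ∈ S, ‖(z a).2 - cmVel S z‖ ^ 2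

/-- Internal impulse of `S` over the times in `I` along the curve `γ` (Euclidean geometry, diameter `ε`):
`Σ_{collisions (i,j), i,j ∈ S, ordered} ‖v_i⁺ − v_i⁻‖ = 2 Σ_{internal collisions} |[v]|`. -/
def internalImpulse (ε : ℝ) (γ : ℝ → Config n (Fin 3) V3) (S : Finset (Fin n)) (I : Set ℝ) : ℝ :=
  Literature.Analysis.FluidPDE.collisionSum (Euclidean.geometry (Fin 3)) ε γ I
    (fun c => if c.fst ∈ S ∧ c.snd ∈ S then ‖c.postVel.1 - c.preVel.1‖ else 0)

/-- External impulse received by `S` over the times in `I`: `Σ_{collisions (i,j), i ∈ S, j ∉ S} ‖v_i⁺ − v_i⁻‖`. -/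
def externalImpulse (ε : ℝ) (γ : ℝ → Config n (Fin 3) V3) (S : Finset (Fin n)) (I : Set ℝ) : ℝ :=
  Literature.Analysis.FluidPDE.collisionSum (Euclidean.geometry (Fin 3)) ε γ I
    (fun c => if c.fst ∈ S ∧ c.snd ∉ S then ‖c.postVel.1 - c.preVel.1‖ else 0)

end Cluster

/-! ## §1 Statements of the line (Props; the stubs assert them or implications between them) -/

/-- **CLUSTER VIRIAL BUDGET** (the deterministic lever; two conjuncts). For every hard-sphere trajectory `γ` of `n`
spheres of diameter `ε > 0` in `ℝ³` (`IsHardSphereTrajectory`), every cluster `S` and times `t₁ ≤ t₂`: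
(ISOLATED) if no contact pair straddles `S` on `[t₁, t₂]`, then `ε · internalImpulse ≤ 4 √(2 K_S I_S)(t₁)`
(CM-frame Lagrange–Jacobi: `b_S(t₂) − b_S(t₁) = 2K_S(t₂−t₁) + ε Σ_int|[v]|`, `b_S ≤ √(2K_S I_S)`, `√I_S` is
`√(2K_S)`-Lipschitz; the factor 4 = 2 × ordered pairs);
(FED) in general, if `‖x_a(t) − X_S(t)‖ ≤ R` for `a ∈ S`, `t ∈ [t₁,t₂]`, then
`ε · internalImpulse ≤ 2√(2K_S I_S)(t₁) + 2√(2K_S I_S)(t₂) + 2 R · externalImpulse` (the same identity with the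
lever-arm import term `⟪x_i − X_S, Δv_i⟫` at external collisions, `−2∫K_S ≤ 0` dropped).
CIP1994 Lemma 4.2.3 (and Remark p. 66: false on `Λ ≠ ℝ³` — whence clusters, cf. NegativeNotes N2), Vaserstein1979,
Illner1989, BuragoFerlegerKononenko1998. Provable now over the tree's trajectory kit. -/
def ClusterVirialBudget : Prop :=
  (∀ (ε : ℝ) (n : ℕ) (γ : ℝ → Config n (Fin 3) V3), 0 < ε →
    IsHardSphereTrajectory (Euclidean.geometry (Fin 3)) ε n γ →
    ∀ (S : Finset (Fin n)) (t₁ t₂ : ℝ), t₁ ≤ t₂ →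
    (∀ t ∈ Set.Icc t₁ t₂, ∀ p ∈ contactPairs (Euclidean.geometry (Fin 3)) ε (γ t), p.1 ∈ S → p.2 ∈ S) →
    ε * internalImpulse ε γ S (Set.Ioc t₁ t₂) ≤
      4 * Real.sqrt (2 * cmKinetic S (γ t₁) * cmInertia S (γ t₁))) ∧
  (∀ (ε : ℝ) (n : ℕ) (γ : ℝ → Config n (Fin 3) V3), 0 < ε →
    IsHardSphereTrajectory (Euclidean.geometry (Fin 3)) ε n γ →
    ∀ (S : Finset (Fin n)) (t₁ t₂ R : ℝ), t₁ ≤ t₂ →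
    (∀ t ∈ Set.Icc t₁ t₂, ∀ a ∈ S, ‖(γ t a).1 - cmPos S (γ t)‖ ≤ R) →
    ε * internalImpulse ε γ S (Set.Ioc t₁ t₂) ≤
      2 * Real.sqrt (2 * cmKinetic S (γ t₁) * cmInertia S (γ t₁)) +
      2 * Real.sqrt (2 * cmKinetic S (γ t₂) * cmInertia S (γ t₂)) +
      2 * R * externalImpulse ε γ S (Set.Ioc t₁ t₂))

/-- **MESOSCOPIC JAMMED-SET SUPEREXPONENTIAL ESTIMATE AT EQUILIBRIUM** (the card's C⁺, re-aimed at the static clamp;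
the LOAD-BEARING open statement of the line). Under the flow-invariant homogeneous Gibbs law `G_N` (constant profiles
`a, θ, u₀`, reduced density `σ < σ₀`): for over-density levels `Λ` in a compact range `[Λ₁, Λ₂] ⊂ (1, ∞)` (local
uniformity in the level: the dock consumes the statement blockwise at the continuum of levels `Λ/ρ̂_block`), horizon `T`,
amplitude `β` and `ε > 0` there are a macroscopic radius `ρ₀`, a clamp scale `L`, a contact tolerance `g₀` and a window
threshold `τ₀` such that for `τ ≥ τ₀`, `N ≥ N₀` and every flow, `(N+1)⁻¹ log E_{G_N} exp(β · mesoBadActivity) ≤ ε`.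
Quantifier order `∀β ∀ε ∃(ρ₀, L, g₀)` (level AFTER amplitude — the only order in which such an estimate is true, see the
module docstring); the DOCK consumes it per macroscopic stretch `Δ` with the RUNNING entropy `H(f_t|ψ_t) = o(N)` and its
blockwise localisation engine (β a free large constant, hence `ρ₀, L, g₀` fixed by β and the accuracy, NOT by `1/H`).
Finite at every `N ≥ N₀(β)`: the worst velocity dependence is a fast sphere (speed `u`) cascading inside a bad cluster,
`Σ‖Δv‖ ≍ u²/√θ`, gain `β σ ℓ u²/√θ` against the Maxwellian `u²/2θ`. Content: (i) explosion budgets make the integrated activity of every bad cluster bounded by its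
`2√(2K_S I_S)` (+ fed import), which for a mesoscopic cluster of `n` members is `O(σ√θ n^{4/3} ℓ)` — vanishing per particle
— while refinement makes each bad particle statically EXPENSIVE (`≳ Λ-overdensity cost · L³` or `log(1/(g₀σ³))`), so
gain/cost `→ 0`; (ii) patterns of macroscopic radius `≥ ρ₀(β)` are excluded by `IsMacro`; (iii) ANTI-FOCUSING (K2): under
the measure-preserving equilibrium flow, chains of implosions re-compressing the same matter are LD-costly
(stationarity: pre-images of a jammed set have its Gibbs mass; kinematics: re-compression of a region of size `r` takes
time `≥ r/C`). Fails iff LD-cheap focusing cascades exist at fixed `σ` (the particle-level shadow of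
ImplosionDichotomy.DenseExcursion) or if elongated contact networks realise their (length-inflated) virial budget. -/
def MesoJammedSetLd : Prop :=
  ∀ (a θ : ℝ) (u₀ : V3), 0 < a → 0 < θ → ∃ σ₀ : ℝ, 0 < σ₀ ∧ ∀ σ : ℝ, 0 < σ → σ < σ₀ →
    ∀ Λ₁ Λ₂ : ℝ, 1 < Λ₁ → Λ₁ ≤ Λ₂ → ∀ T : ℝ, 0 < T → ∀ β : ℝ, 0 < β → ∀ ε : ℝ, 0 < ε →
    ∃ ρ₀ : ℝ, 0 < ρ₀ ∧ ∃ L : ℝ, 0 < L ∧ ∃ g₀ : ℝ, 0 < g₀ ∧ ∃ τ₀ : ℝ, 0 < τ₀ ∧ ∀ τ : ℝ, τ₀ ≤ τ →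
    ∃ N₀ : ℕ, ∀ Λ : ℝ, Λ₁ ≤ Λ → Λ ≤ Λ₂ → ∀ N : ℕ, N₀ ≤ N → ∀ Φ : TFlow σ N,
      ∫⁻ z, ENNReal.ofReal (Real.exp (β * mesoBadActivity Φ Λ ρ₀ L g₀ τ T z))
          ∂(localGibbsLaw σ (fun _ => a) (fun _ => u₀) (fun _ => θ) N Φ) ≤
        ENNReal.ofReal (Real.exp (ε * ((N : ℝ) + 1)))

/-- **STATIC-CLAMPED COLLISIONAL-TRANSFER WINDOW LD AT EQUILIBRIUM** (this line's collisional twin; TwoClocks'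
`EquilibriumClampedCollisionalWindowLD` 13733 with the ACTIVITY clamp `1{a_i ≤ V}` replaced by the STATIC clamp
`1{i ∉ IsBad σ Λ L g₀ (window start)}` and the EOS-projection coefficients allowed an `η`-error that vanishes under
refinement). Frame of 13733 (universal `σ₀`; constants `a₀, θ₀, u₀`; `G_N` flow-invariant; smooth `φ`); `Z = Z(σ³)`,
`Z'` its derivative (`hsCompressibility`). KEY CLAUSE: the amplitude `β₀` and the slope `M` are chosen BEFORE the clamp
parameters `(L, g₀)` and locally uniformly in the level `Λ ∈ [Λ₁, Λ₂]`; the bound is claimed only for windows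
`τ ≥ M·L` — statically-good matter is hyperactive only transiently (explosion budget ∝ extent `∝ L ℓ` against the window
`τ ℓ`), so refinement costs amplitude like `τ/L`, which long windows restore. Momentum components `k` and energy.
Fails as 13733 does (no control of scale-`N` exponential moments beyond Lanford's time at fixed `σ³`: the fixed-density
kinetic wall on the collisional side), or if statically-good configurations can sustain activity `≫ θ` over a whole long
window at sub-extensive cost (fed loose cages; elongated contact networks formed within one window). -/
def StaticClampedCollisionalLd : Prop :=
  ∃ σ₀ : ℝ, 0 < σ₀ ∧ ∀ (a₀ θ₀ : ℝ) (u₀ : V3), 0 < a₀ → 0 < θ₀ → ∀ σ : ℝ, 0 < σ → σ < σ₀ →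
  ∀ φ : T3 → ℝ, Literature.Analysis.FunctionSpaces.Torus.IsSmooth φ →
  ∀ Λ₁ Λ₂ : ℝ, 1 < Λ₁ → Λ₁ ≤ Λ₂ →
  ∃ β₀ : ℝ, 0 < β₀ ∧ ∃ M : ℝ, 0 < M ∧
  ∀ η : ℝ, 0 < η → ∃ L₀ : ℝ, 0 < L₀ ∧ ∃ g₁ : ℝ, 0 < g₁ ∧
  ∀ L : ℝ, L₀ ≤ L → ∀ g₀ : ℝ, 0 < g₀ → g₀ ≤ g₁ → ∀ Λ : ℝ, Λ₁ ≤ Λ → Λ ≤ Λ₂ →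
  ∃ c₁ c₂ c₃ : ℝ,
    |c₁ - θ₀ * σ ^ 3 * deriv hsCompressibility (σ ^ 3)| + |c₂ - (hsCompressibility (σ ^ 3) - 1) / 3| +
      |c₃ - θ₀ * (hsCompressibility (σ ^ 3) - 1)| ≤ η ∧
  ∀ β : ℝ, |β| ≤ β₀ → ∀ ε : ℝ, 0 < ε → ∃ τ₀ : ℝ, 0 < τ₀ ∧ ∀ τ : ℝ, τ₀ ≤ τ → M * L ≤ τ →
  ∃ N₀ : ℕ, ∀ N : ℕ, N₀ ≤ N → ∀ Φ : TFlow σ N,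
  (let w : ℝ := window τ N
   let P := localGibbsLaw σ (fun _ => a₀) (fun _ => u₀) (fun _ => θ₀) N Φ
   let ω := fun (i : Fin (N + 1)) (z : TConfig N) => if IsBad σ Λ L g₀ z i then (0 : ℝ) else 1
   let Xm := fun (k : Fin 3) (z : TConfig N) =>
     Φ.collisionSum (Set.Ioc 0 w)
       (fun c => ω c.fst z * ω c.snd z * ((φ c.fstPos - φ c.sndPos) * (c.postVel.1 k - c.preVel.1 k)) / 2) z
   let Am := fun (k : Fin 3) (z : TConfig N) =>
     ∫ r in (0 : ℝ)..w, ∑ i, Literature.Analysis.FunctionSpaces.Torus.partialDeriv k φ ((Φ.flow r z i).1) *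
       (c₁ + c₂ * ‖(Φ.flow r z i).2 - u₀‖ ^ 2)
   let Xe := fun (z : TConfig N) =>
     Φ.collisionSum (Set.Ioc 0 w)
       (fun c => ω c.fst z * ω c.snd z *
         ((φ c.fstPos - φ c.sndPos) * ((‖c.postVel.1‖ ^ 2 - ‖c.preVel.1‖ ^ 2) / 2)) / 2) z
   let Ae := fun (z : TConfig N) =>
     ∫ r in (0 : ℝ)..w, ∑ i,
       ((∑ l, u₀ l * Literature.Analysis.FunctionSpaces.Torus.partialDeriv l φ ((Φ.flow r z i).1)) *
           (c₁ + c₂ * ‖(Φ.flow r z i).2 - u₀‖ ^ 2) +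
         c₃ * (∑ l, Literature.Analysis.FunctionSpaces.Torus.partialDeriv l φ ((Φ.flow r z i).1) *
           (((Φ.flow r z i).2 - u₀) l)))
   (∀ k : Fin 3, ∫⁻ z, ENNReal.ofReal (Real.exp (β * (w⁻¹ * Xm k z - w⁻¹ * Am k z))) ∂P ≤
       ENNReal.ofReal (Real.exp (ε * ((N : ℝ) + 1)))) ∧
     ∫⁻ z, ENNReal.ofReal (Real.exp (β * (w⁻¹ * Xe z - w⁻¹ * Ae z))) ∂P ≤
       ENNReal.ofReal (Real.exp (ε * ((N : ℝ) + 1))))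

/-- **GAUSSIAN VELOCITY MOMENTS ALONG THE TRUE EVOLUTION** on the small-density range (ideator-3 BN2/BN4; the tree's
open hypothesis `Literature.Barriers.AtomisticToContinuum.HighMomentumCutoff`, Nachtergaele–Yau Assumption II.1
transcribed): the velocity-tail child of every kinetic-window Gronwall, used through Chebyshev, never through the entropy
inequality (Disproof §4). -/
def GaussianTailsAlongEvolution : Prop :=
  ∃ σ₀ : ℝ, 0 < σ₀ ∧ ∀ σ : ℝ, 0 < σ → σ < σ₀ → Literature.Barriers.AtomisticToContinuum.HighMomentumCutoff σ

/-- **THE DOCK INPUTS THIS LINE INHERITS VERBATIM** (one registered stub for the five filed children of every Yau-family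
dock that this line does not touch — all on the VELOCITY / STATICS / PDE side, none on the jamming side): Gaussian velocity
moments along the true law (`HighMomentumCutoff σ`, σ < σ₀) and the cubic uniform integrability of the energy current in
mean (TwoClocks 9235 `EnergyCurrentTails`) — together they pay the `{‖w‖ > A}` truncation of the heat flux and the
fast-collision excess `ε_N Σ_c ‖Δv‖(‖v̄‖ − C)₊` of the energy-transfer remainder (each cascade is charged `ε_N u² log u`,
`o(1)` per particle in mean); the η₀-uniform exponential LLN for canonical local Gibbs states (14445: also the reference
cost of the macroscopic-blob events of the dock); the low-density hard-sphere equation of state (0768); and dilute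
self-consistency of the tied classical hs-Euler solutions (3091 — the density guard without which no blockwise use of a
dilute-only hypothesis covers compressive solutions; N4 / X3 / BN1 of ideator 1). -/
def InheritedDockInputs : Prop :=
  GaussianTailsAlongEvolution ∧ EnergyCurrentTails ∧ UniformLocalGibbsConcentration ∧ HsEosLowDensity ∧
    DiluteSelfConsistency

/-- **THE KINETIC HYPOTHESIS IN THE FORM THE LEDGER CAN CONSUME** (ideator-3 `KineticFluxLdDecayQuad` + triage S2):
`KineticFluxLdDecay` with (i) the amplitude `κ` chosen BEFORE `σ` (BN3), (ii) the QUADRATIC-GROWTH class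
`|g(w)| ≤ κ(1 + ‖w‖²)` (BN1: the truncated heat flux `q χ_A / A` then has an `A`-independent constant, Gronwall rate `∝ A`,
which Gaussian tails beat — Nachtergaele–Yau's `δ⁻¹M`), (iii) the window `τ` and threshold `N₀` locally uniform in `σ`
on compacts `[σ₁, σ₀)` (S2: the dock consumes the hypothesis at the continuum of reduced densities `σ ρ̂^{1/3}` met by the
blocks of the reference). Any proof of 10967 by covariance/compactness yields this form; as TYPED, 10967 does not. -/
def KineticFluxLdDecayQuadLocUnif : Prop :=
  ∀ (a θ : ℝ) (u₀ : V3), 0 < a → 0 < θ → ∃ σ₀ : ℝ, 0 < σ₀ ∧ ∃ κ : ℝ, 0 < κ ∧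
    (∀ σ : ℝ, 0 < σ → σ < σ₀ → ∀ (N : ℕ) (Φ : TFlow σ N),
      IsProbabilityMeasure (localGibbsLaw σ (fun _ => a) (fun _ => u₀) (fun _ => θ) N Φ)) ∧
    ∀ (φ : T3 → ℝ) (g : V3 → ℝ), Continuous φ → Continuous g → (∀ x, |φ x| ≤ 1) →
      (∀ v, |g v| ≤ κ * (1 + ‖v‖ ^ 2)) →
      (∀ (c₀ c₂ : ℝ) (b : V3),
        ∫ v, g v * (c₀ + inner ℝ b v + c₂ * ‖v‖ ^ 2) ∂(ProbabilityTheory.stdGaussian V3) = 0) →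
      ∀ δ : ℝ, 0 < δ → ∀ σ₁ : ℝ, 0 < σ₁ → σ₁ < σ₀ → ∃ τ : ℝ, 0 < τ ∧ ∃ N₀ : ℕ,
        ∀ σ : ℝ, σ₁ ≤ σ → σ < σ₀ → ∀ N : ℕ, N₀ ≤ N → ∀ Φ : TFlow σ N,
          ∫⁻ z, ENNReal.ofReal (Real.exp ((window τ N)⁻¹ *
              ∫ s in (0 : ℝ)..(window τ N),
                ∑ i, φ (Φ.flow s z i).1 * g ((Real.sqrt θ)⁻¹ • ((Φ.flow s z i).2 - u₀))))
            ∂(localGibbsLaw σ (fun _ => a) (fun _ => u₀) (fun _ => θ) N Φ) ≤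
          ENNReal.ofReal (Real.exp (δ * ((N : ℝ) + 1)))

/-- **THE STATIC-CLAMP DOCK** (the entropy clock of this line; Yau1991 / OllaVaradhanYau1993 §3 / KipnisLandim1999 Ch. 6,
Nachtergaele–Yau bookkeeping, Disproof `discreteWindowGronwall_exp`). From the σ-locally-uniform quadratic-class kinetic
window LD, the static-clamped collisional window LD, the EQUILIBRIUM mesoscopic jammed-set estimate, Gaussian velocity
moments and cubic UI along the true law, the uniform local-Gibbs LLN, the low-density EOS and dilute self-consistency,
conclude `RelEntropyVanishing` VERBATIM (tie and balance laws used: Disproof §2–§3). Proof shape: `σ₀ := min` of the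
inputs'; clamp level `Λ :=` a fixed fraction of close packing over `σ³` relative to the local density (between
`2 sup ρ` and packing: the dilute guard makes room), so that Λ-overdense = near-packed; per kinetic window the h-weighted
entropy-inequality increment `(h/γ)[H + P]` (X1). KINETIC part: exact affine cancellation against the Euler equations in
entropy variables; fast part fed blockwise to the kinetic LD after static block-freezing (Rényi `O(N r²)`), 27-colour
chessboard, hard-core DLR/Markov factorisation, `ψ_t ≤ e^{KN} G_hot` to transfer locality bad sets (merged localisation
line dlr-block-transfer / self-similar-block-periodisation / locality-inside-the-pressure), truncated heat flux at
amplitude `≍ 1/A`, `{‖w‖ > A}` paid by the Gaussian tails through Chebyshev. COLLISIONAL part: STATIC clamp read off the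
window-start configuration; clamped functional to `StaticClampedCollisionalLd` (blockwise, same engine) at amplitude `β₀`
with `τ ≥ M L`, EOS coefficients matched up to `η` (a source); clamp remainder `≤ 2 c_λ Σ_{bad collisions} ε_N‖Δv‖(1+‖v̄‖)`:
(i) its MESOSCOPIC activity part per macroscopic stretch `Δ` by the entropy inequality w.r.t. `ψ_t` with the RUNNING
entropy, `E^{f_t}[F_Δ] ≤ β₁⁻¹[H(t) + log E_{ψ_t} e^{β₁ F_Δ}]`, `β₁` a FIXED large constant, the log-moment localised
blockwise to `MesoJammedSetLd` at the blocks' levels `Λ/ρ̂` (local uniformity in the level) — rate `1/(β₁Δ)`, source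
`ε N/(β₁ Δ)`; (ii) its MACROSCOPIC part (`IsMacro`: near-packed balls of radius `ρ₀(β₁)`, finitely many dyadic sizes
`α ∈ [α₀(β₁), 1]`) in COUNT currency with the running entropy — `E^{f_t}[#α-blobs] ≤ γ_α⁻¹[H(t) + log E_{ψ_t} e^{γ_α #}]`,
reference cost from `UniformLocalGibbsConcentration` on a finite net of balls — against the BOUNDED weight given by the
fed `ClusterVirialBudget` on the blob over its assembly time `≍ radius/C` (one-time explosion budget `≲ 4 α N C · radius`
plus feeding `≲ θ` per particle per unit time; speeds `> C` paid by the Gaussian tails): a FIXED coefficient in the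
Gronwall rate (the number of scales is fixed because `β₁` is); (iii) the fast-collision energy excess by the velocity
inputs in mean. Order of choices: accuracy ε → (A, C, β₁) → (ρ₀, L, g₀) → η → τ ≥ max(τ₀'s, M L) → N₀ → ε → 0 last;
rate fixed, sources → 0, `H(0) = 0` by the tie. WHY NOT the card's global transfer (path-space entropy vs the invariant
`G`, budget `c₁ N`; equivalently `ψ₀ ≤ e^{KN} G_hot` + Jensen): it forces `β = K/ε → ∞`, hence `ρ₀(ε) → 0`, and the
macroscopic bookkeeping then runs over `≍ log(1/ε)` dyadic scales each adding `O(1)` to the rate — a Gronwall factor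
`ε^{-cT}` against sources `O(ε)`, which closes only for `T < 1/c`. -/
def StaticClampDock : Prop :=
  KineticFluxLdDecayQuadLocUnif → StaticClampedCollisionalLd → MesoJammedSetLd →
    GaussianTailsAlongEvolution → EnergyCurrentTails → UniformLocalGibbsConcentration → HsEosLowDensity →
    DiluteSelfConsistency → RelEntropyVanishing

/-! ## §2 Registered stubs -/

/-- STUB 1 (deterministic lever; M; provable now over `IsHardSphereTrajectory` / `collisionSum` / `contactPairs`;
`virial_freeFlight` is the free-flight half for `S = univ`). -/
theorem stub_clusterVirialBudget : ClusterVirialBudget := by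
  sorry

/-- STUB 2 (LOAD-BEARING, XL): explosion budgets + statics of the refined clamp + anti-focusing (K2) ⟹ the mesoscopic
jammed-set superexponential estimate at equilibrium. The lever enters through the hypothesis; this is the card's C⁺ in
the order in which it is true, aimed at the set the dock actually clamps. -/
theorem stub_mesoJammedSetLd : ClusterVirialBudget → MesoJammedSetLd := by
  sorry

/-- STUB 3 (collisional twin with the static clamp; open-problem grade as 13733; same wall as TwoClocks #3). -/
theorem stub_staticClampedCollisionalLd : StaticClampedCollisionalLd := by
  sorry

/-- STUB 4 (inherited children, GIVEN: Gaussian tails `HighMomentumCutoff`, 9235, 14445, 0768, 3091). -/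
theorem stub_inheritedDockInputs : InheritedDockInputs := by
  sorry

/-- STUB 5 (THE CRUX'S TYPING DEBT, not mathematics this line attacks): bounded-class, pointwise-in-σ 10967 ⟹ the
σ-locally-uniform quadratic-class form. BN1(e): not provable by truncation or convexity — as typed it secretly contains
the quadratic-class statement; it becomes `fun _ => h` the day 10967 is re-typed as requested (ideator 3, triage ×3)
and proved in that form. Kept as a named stub so that the debt is visible and nothing else in the skeleton depends on it. -/
theorem stub_kineticClassUpgrade : KineticFluxLdDecay → KineticFluxLdDecayQuadLocUnif := by
  sorry

/-- STUB 6 (XL): the static-clamp dock (uses STUB 1 again, as a theorem, for the macroscopic-blob weights). -/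
theorem stub_staticClampDock : StaticClampDock := by
  sorry

/-! ## §3 The composition (kernel-checked, no sorry of its own): the six stubs imply the crux BY NAME -/

/-- `stub₁ → … → stub₆ → KineticWindowGronwall`: pure logic. The deterministic budget feeds the equilibrium jammed-set
estimate, and the dock assembles that with the upgraded kinetic hypothesis, the static-clamped collisional LD and the
inherited children into `RelEntropyVanishing`; the antecedent of the crux enters through the typing-debt stub only. -/
theorem KineticWindowGronwall_of :
    ClusterVirialBudget →
    (ClusterVirialBudget → MesoJammedSetLd) →
    StaticClampedCollisionalLd →
    InheritedDockInputs →
    (KineticFluxLdDecay → KineticFluxLdDecayQuadLocUnif) →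
    StaticClampDock →
    Summit.AtomisticToContinuum.HydrodynamicLimit.Theses.AntiMazurCoboundaries.KineticWindowGronwall :=
  fun h₁ h₂ h₃ h₄ h₅ h₆ hA => h₆ (h₅ hA) h₃ (h₂ h₁) h₄.1 h₄.2.1 h₄.2.2.1 h₄.2.2.2.1 h₄.2.2.2.2

/-- The crux from the registered stubs (one line; every `sorry` sits inside a `stub_*`). -/
theorem KineticWindowGronwall_skeleton :
    Summit.AtomisticToContinuum.HydrodynamicLimit.Theses.AntiMazurCoboundaries.KineticWindowGronwall :=
  KineticWindowGronwall_of stub_clusterVirialBudget stub_mesoJammedSetLd stub_staticClampedCollisionalLd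
    stub_inheritedDockInputs stub_kineticClassUpgrade stub_staticClampDock

/-- The shared sibling decl (route FluxGibbsianityLdDrude, same item 9282) is the same term, so the skeleton serves both. -/
example : Summit.AtomisticToContinuum.HydrodynamicLimit.Theses.AntiMazurCoboundaries.KineticWindowGronwall =
    Summit.AtomisticToContinuum.HydrodynamicLimit.Theses.FluxGibbsianityLdDrude.KineticWindowGronwall := rfl

/-- The skeleton's registered entry point (`<Crux>_proof`, the item's primary decl — route FluxGibbsianityLdDrude; the
AntiMazurCoboundaries decl is the same term): the crux from the six `stub_*` (every `sorry` sits inside a stub). -/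
theorem KineticWindowGronwall_proof :
    Summit.AtomisticToContinuum.HydrodynamicLimit.Theses.FluxGibbsianityLdDrude.KineticWindowGronwall :=
  KineticWindowGronwall_skeleton

/-- … and by name for the AntiMazurCoboundaries decl, directly from the composition. -/
theorem KineticWindowGronwall_proof' :
    Summit.AtomisticToContinuum.HydrodynamicLimit.Theses.AntiMazurCoboundaries.KineticWindowGronwall :=
  KineticWindowGronwall_of stub_clusterVirialBudget stub_mesoJammedSetLd stub_staticClampedCollisionalLd
    stub_inheritedDockInputs stub_kineticClassUpgrade stub_staticClampDock

/-! ## §4 Negative knowledge honoured (landed `Theorems/KineticWindowGronwall/Negative/*`, imported above) -/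

/-- Disproof §4 / `Negative/CubicMomentDiverges`: cubic exponential moments of a Maxwellian are infinite — the reason
`jact` carries no velocity weight and the velocity tails are TRUE-LAW inputs. -/
theorem honours_cubic {α : ℝ} (hα : 0 < α) :
    ∫⁻ x, ENNReal.ofReal (Real.exp (α * x ^ 3)) ∂(ProbabilityTheory.gaussianReal 0 1) = ∞ :=
  Summit.AtomisticToContinuum.HydrodynamicLimit.Theorems.KineticWindowGronwallNegative.lintegral_exp_mul_pow_three_eq_top hα

/-- Disproof §2 / `Negative/ConsequentLoadBearing`: given the antecedent, the UNTIED consequent is false — the dock keeps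
the `t = 0` tie (`H(f₀|ψ₀) = 0`) and the Euler balance laws; its conclusion is `RelEntropyVanishing` verbatim. -/
theorem honours_tie (hA : KineticFluxLdDecay) :
    ¬ (KineticFluxLdDecay →
      Summit.AtomisticToContinuum.HydrodynamicLimit.Theorems.KineticWindowGronwallNegative.RelEntropyVanishingUntied) :=
  Summit.AtomisticToContinuum.HydrodynamicLimit.Theorems.KineticWindowGronwallNegative.crux_untied_false_of_antecedent hA

end Summit.AtomisticToContinuum.HydrodynamicLimit.Cruxes.KineticWindowGronwall.ExplosionLimitedJamming

end
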